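import Summits.Ventures.YMGap.Thresholds.TiltOscillationVariance
import Summits.QuantumFields.BalabanUV.InfraRed.StrongCouplingPoincareDoorSUN
import HarnessLib

/-!
# The robust one-link lemma: Holley–Stroock in Lipschitz form for the perturbed one-link law of `SU(N)` lattice Yang–Mills

HONEST FRAMING.  Explicit strong-coupling constants for lattice `SU(N)` Yang–Mills (small `β`): a measure-theoretic transfer
lemma for ONE tilted Haar law on `SU(N)`.  NOT weak coupling, NOT a continuum statement, NOT a Yang–Mills mass-gap claim.
Cell `pub-ymgap` (venture `YMGap`), track Y2 ROBUST-BALL (PLAN amendment 50, crux (ii) «the robust one-link lemma»; rulings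
R145/R146), seat engine-2 (g5).  Nothing is asserted about any certificate: the two one-link inputs enter as the tree's
HYPOTHESIS SCHEMAS `OneLinkPoincareSUN N R c` / `OneLinkVarianceBound N R v`.

THE OBJECT.  For `B ∈ M_N(ℂ)` and a bounded measurable `U : SU(N) → ℝ` the **perturbed one-link law**
`ν_{B,U}(dg) ∝ exp(N Re tr(g B) + U(g)) Haar(dg)`.  For an action `S_Wilson(β) + V`, `V = Σ_X V_X` a sum of bounded local
terms, the conditional law of one link `e` given the others is `ν_{B,U}` with `B = β·(staple sum)` and
`U(g) = -Σ_{X ∋ e} V_X(ω^{e ← g})`, of OSCILLATION `≤ δ := Σ_{X ∋ e} osc V_X`; `U ≡ 0` is the Wilson law `ν_B` of every door.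

THE LEMMA.  Part 1 (`Thresholds/TiltOscillationVariance.lean`, abstract probability space) is Holley–Stroock 1987 in Lipschitz form:
if `∀ g h, U g ≤ U h + δ` then `dμ^U/dμ ≤ e^δ` pointwise (`μ^U := e^U μ / μ(e^U)`), hence `Var_{μ^U}(X) ≤ e^δ Var_μ(X)` — ONE factor
`e^δ`, not the `e^{2δ}` of the Dirichlet-form version, because the right side of a Lipschitz-form Poincaré inequality `Var ≤ c·Lip²`
is a constant.  This file (part 2) draws the consequences on the SAME ball `‖B‖_op ≤ R`, uniformly over all `U` of oscillation `≤ δ`: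
* `variance_pert_le_of_oneLinkPoincareSUN` : `OneLinkPoincareSUN N R c` ⇒ `Var_{ν_{B,U}}(ψ) ≤ e^δ c M²` (`ψ` `M`-Lipschitz);
* `variance_lin_pert_le_of_oneLinkVarianceBound` : `OneLinkVarianceBound N R v` ⇒ `Var_{ν_{B,U}}(N Re tr(g Δ)) ≤ e^δ v ‖Δ‖_F²`;
* `abs_integral_pert_sub_le` (TILT direction, `U` fixed): `|∫ φ dν_{B,U} − ∫ φ dν_{B',U}| ≤ e^δ √(c v) · L · ‖B − B'‖_F` — the
  tree's Poincaré–variance modulus (`oneLinkKRModulus_of_poincare_of_varianceBound`: covariance form of the tilt interpolation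
  + Cauchy–Schwarz) re-run with the two perturbed variance bounds;
* `abs_integral_pert_sub_pert_le` (CROSS direction, `B` fixed): `|∫ φ dν_{B,U} − ∫ φ dν_{B,U'}| ≤ √(e^δ c) · L · s` whenever
  `|U − U'| ≤ s` pointwise — interpolation `U_t = U' + t(U − U')` keeps the oscillation `≤ δ`, `|Cov(φ, U − U')| ≤ √(e^δ c) L·s`;
* `abs_integral_pert_sub_pert_le_of_pair` : both directions, `(B,U) → (B',U')` — the line a Dobrushin row sum for
  `S_Wilson + V` consumes: per neighbour `y` of `e`, `e^δ √(cv)·(tilt bookkeeping) + √(e^δ c)·ℓ(e,y)`, `ℓ(e,y)` the Lipschitz load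
  of `V` in link `y` seen from `e`.  A pure sup-norm ball on `V` is NOT what the Wasserstein doors need: the cross term wants a
  per-link Lipschitz seminorm (rb-ref T0.3, LINEAGE-R §0);
* `oneLinkKRModulus_of_pert_zero` : at `U ≡ 0`, `δ = 0` the tilt direction IS `OneLinkKRModulus N R √(c v)` (consistency).
INSTANCES BY NAME: `SU(3)` — the cell's certified pair H1 `OneLinkPoincareSUN 3 (3/5) (4/5)`, H2 `OneLinkVarianceBound 3 (11/30) (49/20)`
(`K = √(cv) = 7/5`); `SU(2)` hypothesis-free — `oneLinkPoincareSUN_two_sharp R` (`c = 2/3`) with `OneLinkVarianceBoundSU2` (`v = 2` on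
`‖B‖_op ≤ 3/10`), `K = √(4/3)`; all `N ≥ 2` — the Bakry–Émery inhabitants of the two door files (`K = 1/(1/2 − R)`).
NOT HERE: no specification, no Dobrushin door, no `(β⋆, ε)` row (rb-p1 / rb-p2 / rb-ref; rb-p1's `RobustBall/RobustOneLink.lean` carries
the same variance-form transfer with the schema bodies written out); the transfer of an ARBITRARY `OneLinkKRModulus` (not of `√(cv)` form)
under LIPSCHITZ `U` is ds-4's disjoint lemma (`Thresholds/TiltStability.lean`, R146).

References: R. Holley, D. Stroock, J. Stat. Phys. 46 (1987) 1159–1194 (bounded-perturbation lemma); H. Föllmer, LNM 1362 (1988)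
Ch. I (2.13) (Vasserstein–Dobrushin); H. Shen, R. Zhu, X. Zhu, CMP 400 (2023) (the one-link Bakry–Émery input these schemas carry).
-/

noncomputable section

open MeasureTheory ProbabilityTheory Real
open Literature.MathematicalPhysics.QuantumFieldTheory
open Literature.MathematicalPhysics.QuantumFieldTheory.Balaban1983to89.StrongCouplingDobrushinWindow
open Literature.MathematicalPhysics.QuantumFieldTheory.Balaban1983to89.StrongCouplingKernelWindow
  (abs_integral_tilted_add_sub_le_of_cov)
open Summit.QuantumFields.BalabanUV.InfraRed.StrongCouplingVarianceDoorSUN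
open Summit.QuantumFields.BalabanUV.InfraRed.StrongCouplingPoincareDoorSUN
open Literature.MathematicalPhysics.QuantumFieldTheory.SUNBakryEmery (SUN continuous_of_lipschitz_suFrobDist)

namespace Summit.Ventures.YMGap.OneLinkHolleyStroock

open Summit.Ventures.YMGap.TiltOscillationVariance

/-! ## 1. The perturbed one-link law on `SU(N)`: Poincaré constant, variance bound and the tilt direction -/

section SUN

variable {N : ℕ}

/-- A Frobenius-Lipschitz function on `SU(N)` is bounded: `|ψ g| ≤ |M|·2√N + |ψ 1|`. [folklore] -/
theorem exists_abs_le_of_lipschitz {ψ : SUN N → ℝ} {M : ℝ}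
    (hψ : ∀ a b, |ψ a - ψ b| ≤ M * suFrobDist a b) : ∃ C, ∀ g, |ψ g| ≤ C := by
  refine ⟨|M| * (2 * Real.sqrt N) + |ψ 1|, fun g => ?_⟩
  have h1 : |ψ g - ψ 1| ≤ |M| * (2 * Real.sqrt N) := (hψ g 1).trans ((mul_le_mul_of_nonneg_right (le_abs_self M)
    (suFrobDist_nonneg _ _)).trans (mul_le_mul_of_nonneg_left (suFrobDist_le g 1) (abs_nonneg M)))
  have h2 := abs_add_le (ψ g - ψ 1) (ψ 1)
  rw [sub_add_cancel] at h2
  linarith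

/-- The Wilson tilt `g ↦ N Re tr(g B)` is measurable and bounded by `N √N ‖B‖_F`. [folklore] -/
theorem measurable_tilt (B : Matrix (Fin N) (Fin N) ℂ) :
    Measurable fun g : SUN N => (N : ℝ) * ((g : Matrix (Fin N) (Fin N) ℂ) * B).trace.re :=
  (continuous_const.mul (continuous_re_trace_su_mul B)).measurable

/-- `|N Re tr(g B)| ≤ N √N ‖B‖_F` on `SU(N)`. [folklore] -/
theorem abs_tilt_le (B : Matrix (Fin N) (Fin N) ℂ) (g : SUN N) :
    |(N : ℝ) * ((g : Matrix (Fin N) (Fin N) ℂ) * B).trace.re| ≤ (N : ℝ) * (Real.sqrt N * frobNorm B) := by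
  rw [abs_mul, abs_of_nonneg (Nat.cast_nonneg N)]
  exact mul_le_mul_of_nonneg_left (abs_re_trace_su_mul_le g B) (Nat.cast_nonneg N)

/-- **The perturbed law is the `U`-tilt of the Wilson one-link law**: `ν_{B,U} = (ν_B)^U`. [folklore] -/
theorem pert_eq_tilted_tilted (B : Matrix (Fin N) (Fin N) ℂ) (U : SUN N → ℝ) :
    ((haarProbability (SUN N)).tilted fun g : SUN N => (N : ℝ) * ((g : Matrix (Fin N) (Fin N) ℂ) * B).trace.re + U g) =
      (((haarProbability (SUN N)).tilted fun g : SUN N => (N : ℝ) * ((g : Matrix (Fin N) (Fin N) ℂ) * B).trace.re)).tilted U := by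
  rw [tilted_tilted (integrable_exp_of_abs_le (measurable_tilt B) ⟨_, abs_tilt_le B⟩) U]
  rfl

/-- The Wilson one-link law is a probability measure. [folklore] -/
theorem isProbabilityMeasure_wilson (B : Matrix (Fin N) (Fin N) ℂ) :
    IsProbabilityMeasure ((haarProbability (SUN N)).tilted fun g : SUN N => (N : ℝ) * ((g : Matrix (Fin N) (Fin N) ℂ) * B).trace.re) :=
  isProbabilityMeasure_tilted (integrable_exp_of_abs_le (measurable_tilt B) ⟨_, abs_tilt_le B⟩)

/-- The perturbed one-link law is a probability measure (bounded measurable `U`). [folklore] -/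
theorem isProbabilityMeasure_pert (B : Matrix (Fin N) (Fin N) ℂ) {U : SUN N → ℝ} (hUm : Measurable U)
    (hUb : ∃ C, ∀ g, |U g| ≤ C) :
    IsProbabilityMeasure ((haarProbability (SUN N)).tilted fun g : SUN N => (N : ℝ) * ((g : Matrix (Fin N) (Fin N) ℂ) * B).trace.re + U g) := by
  obtain ⟨C, hC⟩ := hUb
  exact isProbabilityMeasure_tilted (integrable_exp_of_abs_le ((measurable_tilt B).add hUm)
    ⟨(N : ℝ) * (Real.sqrt N * frobNorm B) + C, fun s => (abs_add_le _ _).trans (add_le_add (abs_tilt_le B s) (hC s))⟩)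

/-- **Perturbed Poincaré constant**: `OneLinkPoincareSUN N R c` gives, for every `‖B‖_op ≤ R`, every bounded measurable
`U` of oscillation `≤ δ` and every `M`-Lipschitz `ψ`, `Var_{ν_{B,U}}(ψ) ≤ e^δ c M²` (Holley–Stroock, one factor).
[folklore] -/
theorem variance_pert_le_of_oneLinkPoincareSUN {R c δ : ℝ} (hP : OneLinkPoincareSUN N R c)
    {B : Matrix (Fin N) (Fin N) ℂ} (hB : matrixOpNorm B ≤ R)
    {U : SUN N → ℝ} (hUm : Measurable U) (hUb : ∃ C, ∀ g, |U g| ≤ C)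
    (hosc : ∀ g h, U g ≤ U h + δ) (ψ : SUN N → ℝ) (M : ℝ) (hM : 0 ≤ M)
    (hψ : ∀ a b, |ψ a - ψ b| ≤ M * suFrobDist a b) :
    Var[ψ; ((haarProbability (SUN N)).tilted fun g : SUN N => (N : ℝ) * ((g : Matrix (Fin N) (Fin N) ℂ) * B).trace.re + U g)] ≤ exp δ * c * M ^ 2 := by
  have hψm : Measurable ψ := (continuous_of_lipschitz_suFrobDist hψ).measurable
  haveI := isProbabilityMeasure_wilson (N := N) B
  rw [pert_eq_tilted_tilted, mul_assoc]
  exact (variance_tilted_le_exp_mul hUm hUb hosc hψm (exists_abs_le_of_lipschitz hψ)).trans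
    (mul_le_mul_of_nonneg_left (hP B hB ψ M hM hψ) (exp_pos _).le)

/-- **Perturbed variance bound**: `OneLinkVarianceBound N R v` gives, for every `‖B‖_op ≤ R`, every bounded measurable
`U` of oscillation `≤ δ` and every direction `Δ`, `Var_{ν_{B,U}}(N Re tr(g Δ)) ≤ e^δ v ‖Δ‖_F²`. [folklore] -/
theorem variance_lin_pert_le_of_oneLinkVarianceBound {R v δ : ℝ} (hV : OneLinkVarianceBound N R v)
    {B : Matrix (Fin N) (Fin N) ℂ} (hB : matrixOpNorm B ≤ R)
    {U : SUN N → ℝ} (hUm : Measurable U) (hUb : ∃ C, ∀ g, |U g| ≤ C)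
    (hosc : ∀ g h, U g ≤ U h + δ) (Δ : Matrix (Fin N) (Fin N) ℂ) :
    Var[fun g : SUN N => (N : ℝ) * ((g : Matrix (Fin N) (Fin N) ℂ) * Δ).trace.re;
      ((haarProbability (SUN N)).tilted fun g : SUN N => (N : ℝ) * ((g : Matrix (Fin N) (Fin N) ℂ) * B).trace.re + U g)] ≤ exp δ * v * frobNorm Δ ^ 2 := by
  haveI := isProbabilityMeasure_wilson (N := N) B
  rw [pert_eq_tilted_tilted, mul_assoc]
  exact (variance_tilted_le_exp_mul hUm hUb hosc (measurable_tilt Δ) ⟨_, abs_tilt_le Δ⟩).trans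
    (mul_le_mul_of_nonneg_left (hV B hB Δ) (exp_pos _).le)

/-- **The tilt direction (robust Poincaré–variance modulus).**  `OneLinkPoincareSUN N R c` and `OneLinkVarianceBound N R v`
(`0 ≤ c`, `0 ≤ v`) give, uniformly over bounded measurable `U` of oscillation `≤ δ`: for `‖B‖_op, ‖B'‖_op ≤ R` and every
bounded measurable `L`-Lipschitz `φ`, `|∫ φ dν_{B,U} − ∫ φ dν_{B',U}| ≤ e^δ √(c v) · L · ‖B − B'‖_F` — the tree's
`oneLinkKRModulus_of_poincare_of_varianceBound` along `B_t = B + t(B' − B)` with the two perturbed variance bounds.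
[cite: Follmer1988, Ch. I Theorem (2.13)] -/
theorem abs_integral_pert_sub_le {R c v δ : ℝ} (hc : 0 ≤ c) (hv0 : 0 ≤ v) (hP : OneLinkPoincareSUN N R c)
    (hV : OneLinkVarianceBound N R v)
    {U : SUN N → ℝ} (hUm : Measurable U) (hUb : ∃ C, ∀ g, |U g| ≤ C)
    (hosc : ∀ g h, U g ≤ U h + δ)
    {B B' : Matrix (Fin N) (Fin N) ℂ} (hB : matrixOpNorm B ≤ R) (hB' : matrixOpNorm B' ≤ R)
    (φ : SUN N → ℝ) (L : ℝ) (hφm : Measurable φ) (hφb : ∃ M, ∀ s, |φ s| ≤ M)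
    (hL : 0 ≤ L) (hφL : ∀ a b, |φ a - φ b| ≤ L * suFrobDist a b) :
    |∫ s, φ s ∂((haarProbability (SUN N)).tilted fun g : SUN N => (N : ℝ) * ((g : Matrix (Fin N) (Fin N) ℂ) * B).trace.re + U g) -
        ∫ s, φ s ∂((haarProbability (SUN N)).tilted fun g : SUN N => (N : ℝ) * ((g : Matrix (Fin N) (Fin N) ℂ) * B').trace.re + U g)| ≤
      exp δ * Real.sqrt (c * v) * L * frobNorm (B - B') := by
  obtain ⟨CU, hCU⟩ := hUb
  have hsc : 0 ≤ Real.sqrt (exp δ * c) := Real.sqrt_nonneg _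
  have hsv : 0 ≤ Real.sqrt (exp δ * v) := Real.sqrt_nonneg _
  have hscv : Real.sqrt (exp δ * c) * Real.sqrt (exp δ * v) = exp δ * Real.sqrt (c * v) := by
    rw [← Real.sqrt_mul (mul_nonneg (exp_pos δ).le hc), show exp δ * c * (exp δ * v) = (exp δ) ^ 2 * (c * v) by ring,
      Real.sqrt_mul (sq_nonneg _), Real.sqrt_sq (exp_pos δ).le]
  -- the potentials: `f = N Re tr(g B) + U g`, `w = N Re tr(g (B' - B))`
  have hfw : (fun g : SUN N => (N : ℝ) * ((g : Matrix (Fin N) (Fin N) ℂ) * B').trace.re + U g) =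
      fun g : SUN N => ((N : ℝ) * ((g : Matrix (Fin N) (Fin N) ℂ) * B).trace.re + U g) +
        (N : ℝ) * ((g : Matrix (Fin N) (Fin N) ℂ) * (B' - B)).trace.re := by
    funext g
    simp only [Matrix.mul_sub, Matrix.trace_sub, Complex.sub_re]
    ring
  rw [hfw, abs_sub_comm]
  have hfm : Measurable fun g : SUN N => (N : ℝ) * ((g : Matrix (Fin N) (Fin N) ℂ) * B).trace.re + U g :=
    (measurable_tilt B).add hUm
  have hwm := measurable_tilt (N := N) (B' - B)
  have hfb : ∃ C, ∀ s : SUN N, |(N : ℝ) * ((s : Matrix (Fin N) (Fin N) ℂ) * B).trace.re + U s| ≤ C :=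
    ⟨(N : ℝ) * (Real.sqrt N * frobNorm B) + CU, fun s => (abs_add_le _ _).trans (add_le_add (abs_tilt_le B s) (hCU s))⟩
  rw [frobNorm_sub_comm]
  refine abs_integral_tilted_add_sub_le_of_cov (μ := haarProbability (SUN N)) (A := exp δ * Real.sqrt (c * v) * L *
    frobNorm (B' - B)) hfm hfb hwm (abs_tilt_le (B' - B)) hφm hφb fun t ht => ?_
  · -- the interpolated tilt is the perturbed law at `B_t`, `‖B_t‖_op ≤ R`
    set Bt : Matrix (Fin N) (Fin N) ℂ := B + (t : ℂ) • (B' - B) with hBt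
    have hft : (fun u : SUN N =>
        ((N : ℝ) * ((u : Matrix (Fin N) (Fin N) ℂ) * B).trace.re + U u) +
          t * ((N : ℝ) * ((u : Matrix (Fin N) (Fin N) ℂ) * (B' - B)).trace.re)) =
        fun g : SUN N => (N : ℝ) * ((g : Matrix (Fin N) (Fin N) ℂ) * Bt).trace.re + U g := by
      funext g
      simp only [hBt, Matrix.mul_add, Matrix.mul_smul, Matrix.trace_add, Matrix.trace_smul, Complex.add_re,
        smul_eq_mul, Complex.re_ofReal_mul]
      ring
    have hBt_le : matrixOpNorm Bt ≤ R := by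
      have h1 : Bt = ((1 - t : ℝ) : ℂ) • B + ((t : ℝ) : ℂ) • B' := by
        rw [hBt]
        push_cast
        simp only [smul_sub, sub_smul, one_smul]
        abel
      rw [h1]
      calc matrixOpNorm (((1 - t : ℝ) : ℂ) • B + ((t : ℝ) : ℂ) • B')
          ≤ matrixOpNorm (((1 - t : ℝ) : ℂ) • B) + matrixOpNorm (((t : ℝ) : ℂ) • B') := matrixOpNorm_add_le _ _
        _ = (1 - t) * matrixOpNorm B + t * matrixOpNorm B' := by
            rw [matrixOpNorm_smul, matrixOpNorm_smul, Complex.norm_real, Complex.norm_real, Real.norm_eq_abs,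
              Real.norm_eq_abs, abs_of_nonneg (by linarith [ht.2]), abs_of_nonneg ht.1]
        _ ≤ (1 - t) * R + t * R :=
            add_le_add (mul_le_mul_of_nonneg_left hB (by linarith [ht.2])) (mul_le_mul_of_nonneg_left hB' ht.1)
        _ = R := by ring
    rw [hft]
    haveI := isProbabilityMeasure_pert (N := N) Bt hUm ⟨CU, hCU⟩
    set νt : Measure (SUN N) := ((haarProbability (SUN N)).tilted fun g : SUN N => (N : ℝ) * ((g : Matrix (Fin N) (Fin N) ℂ) * Bt).trace.re + U g) with hνt
    -- the variance of the test function: perturbed Poincaré at `B_t`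
    have hVφ : ∫ s, (φ s - ∫ s', φ s' ∂νt) ^ 2 ∂νt ≤ (Real.sqrt (exp δ * c) * L) ^ 2 / 1 := by
      have hvar := variance_pert_le_of_oneLinkPoincareSUN hP hBt_le hUm ⟨CU, hCU⟩ hosc φ L hL hφL
      rw [variance_eq_integral hφm.aemeasurable] at hvar
      rw [div_one, mul_pow, Real.sq_sqrt (mul_nonneg (exp_pos δ).le hc)]
      exact hvar
    -- the variance of the linear observable: perturbed variance bound at `B_t`
    have hVw : ∫ s, ((N : ℝ) * ((s : Matrix (Fin N) (Fin N) ℂ) * (B' - B)).trace.re -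
        ∫ s', (N : ℝ) * ((s' : Matrix (Fin N) (Fin N) ℂ) * (B' - B)).trace.re ∂νt) ^ 2 ∂νt ≤
        (Real.sqrt (exp δ * v) * frobNorm (B' - B)) ^ 2 / 1 := by
      have hvt := variance_lin_pert_le_of_oneLinkVarianceBound hV hBt_le hUm ⟨CU, hCU⟩ hosc (B' - B)
      rw [variance_eq_integral hwm.aemeasurable] at hvt
      rw [div_one, mul_pow, Real.sq_sqrt (mul_nonneg (exp_pos δ).le hv0)]
      exact hvt
    -- Cauchy–Schwarz
    refine (abs_integral_mul_sub_le_of_variance_le (ν := νt) one_pos (mul_nonneg hsc hL)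
      (mul_nonneg hsv (frobNorm_nonneg _)) hφm hφb hwm ⟨_, abs_tilt_le (B' - B)⟩ hVφ hVw).trans (le_of_eq ?_)
    rw [div_one, ← hscv]; ring

/-! ## 2. The cross direction: two perturbations at the same tilt -/

/-- **The cross direction.**  `OneLinkPoincareSUN N R c` (`0 ≤ c`) gives, for `‖B‖_op ≤ R`, two bounded measurable
perturbations `U, U'` of oscillation `≤ δ` with `|U − U'| ≤ s` pointwise (`U'` bounded, hence `U`), and every bounded
measurable `L`-Lipschitz `φ`: `|∫ φ dν_{B,U} − ∫ φ dν_{B,U'}| ≤ √(e^δ c) · L · s`.  Interpolation `U_t = U' + t(U − U')` (oscillation `≤ δ` by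
convexity), `d/dt ∫ φ dν_t = Cov_{ν_t}(φ, U − U')`, Cauchy–Schwarz with the perturbed Poincaré constant for `φ` and
`Var(U − U') ≤ s²`.  In a Dobrushin row sum this is the influence of a link `y` on `e` through the perturbation terms
`V_X`, `X ∋ e, y`, with `s = ℓ(e,y) · d(ω_y, η_y)`. [cite: Follmer1988, Ch. I Theorem (2.13)] -/
theorem abs_integral_pert_sub_pert_le {R c δ : ℝ} (hc : 0 ≤ c) (hP : OneLinkPoincareSUN N R c)
    {B : Matrix (Fin N) (Fin N) ℂ} (hB : matrixOpNorm B ≤ R)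
    {U U' : SUN N → ℝ} (hUm : Measurable U) (hosc : ∀ g h, U g ≤ U h + δ)
    (hU'm : Measurable U') (hU'b : ∃ C, ∀ g, |U' g| ≤ C)
    (hosc' : ∀ g h, U' g ≤ U' h + δ) {s : ℝ} (hs : ∀ g, |U g - U' g| ≤ s)
    (φ : SUN N → ℝ) (L : ℝ) (hφm : Measurable φ) (hφb : ∃ M, ∀ x, |φ x| ≤ M)
    (hL : 0 ≤ L) (hφL : ∀ a b, |φ a - φ b| ≤ L * suFrobDist a b) :
    |∫ x, φ x ∂((haarProbability (SUN N)).tilted fun g : SUN N => (N : ℝ) * ((g : Matrix (Fin N) (Fin N) ℂ) * B).trace.re + U g) -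
        ∫ x, φ x ∂((haarProbability (SUN N)).tilted fun g : SUN N => (N : ℝ) * ((g : Matrix (Fin N) (Fin N) ℂ) * B).trace.re + U' g)| ≤
      Real.sqrt (exp δ * c) * L * s := by
  obtain ⟨CU', hCU'⟩ := hU'b
  have hsc : 0 ≤ Real.sqrt (exp δ * c) := Real.sqrt_nonneg _
  have hs0 : 0 ≤ s := (abs_nonneg _).trans (hs 1)
  -- the potentials: `f = N Re tr(g B) + U' g`, `w = U g - U' g`
  have hfw : (fun g : SUN N => (N : ℝ) * ((g : Matrix (Fin N) (Fin N) ℂ) * B).trace.re + U g) =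
      fun g : SUN N => ((N : ℝ) * ((g : Matrix (Fin N) (Fin N) ℂ) * B).trace.re + U' g) + (U g - U' g) := by
    funext g; ring
  rw [hfw]
  have hfm : Measurable fun g : SUN N => (N : ℝ) * ((g : Matrix (Fin N) (Fin N) ℂ) * B).trace.re + U' g :=
    (measurable_tilt B).add hU'm
  have hwm : Measurable fun g : SUN N => U g - U' g := hUm.sub hU'm
  have hfb : ∃ C, ∀ x : SUN N, |(N : ℝ) * ((x : Matrix (Fin N) (Fin N) ℂ) * B).trace.re + U' x| ≤ C :=
    ⟨(N : ℝ) * (Real.sqrt N * frobNorm B) + CU', fun x => (abs_add_le _ _).trans (add_le_add (abs_tilt_le B x) (hCU' x))⟩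
  refine abs_integral_tilted_add_sub_le_of_cov (μ := haarProbability (SUN N))
    (A := Real.sqrt (exp δ * c) * L * s) hfm hfb hwm hs hφm hφb fun t ht => ?_
  · -- the interpolated tilt is the perturbed law at `U_t = U' + t (U - U')`, oscillation `≤ δ`
    set Ut : SUN N → ℝ := fun g => U' g + t * (U g - U' g) with hUt
    have hft : (fun u : SUN N =>
        ((N : ℝ) * ((u : Matrix (Fin N) (Fin N) ℂ) * B).trace.re + U' u) + t * (U u - U' u)) =
        fun g : SUN N => (N : ℝ) * ((g : Matrix (Fin N) (Fin N) ℂ) * B).trace.re + Ut g := by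
      funext g; simp only [hUt]; ring
    have hUtm : Measurable Ut := hU'm.add ((hUm.sub hU'm).const_mul t)
    have hUtb' : ∀ g, |Ut g| ≤ CU' + |t| * s := fun g =>
      calc |Ut g| ≤ |U' g| + |t * (U g - U' g)| := abs_add_le _ _
        _ ≤ CU' + |t| * s := by
            rw [abs_mul]; exact add_le_add (hCU' g) (mul_le_mul_of_nonneg_left (hs g) (abs_nonneg t))
    have hUtosc : ∀ g h, Ut g ≤ Ut h + δ := fun g h => osc_interpolate_le hosc hosc' ht g h
    rw [hft]
    haveI := isProbabilityMeasure_pert (N := N) B hUtm ⟨_, hUtb'⟩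
    set νt : Measure (SUN N) := ((haarProbability (SUN N)).tilted fun g : SUN N => (N : ℝ) * ((g : Matrix (Fin N) (Fin N) ℂ) * B).trace.re + Ut g) with hνt
    -- the variance of the test function: perturbed Poincaré at `(B, U_t)`
    have hVφ : ∫ x, (φ x - ∫ x', φ x' ∂νt) ^ 2 ∂νt ≤ (Real.sqrt (exp δ * c) * L) ^ 2 / 1 := by
      have hvar := variance_pert_le_of_oneLinkPoincareSUN hP hB hUtm ⟨_, hUtb'⟩ hUtosc φ L hL hφL
      rw [variance_eq_integral hφm.aemeasurable] at hvar
      rw [div_one, mul_pow, Real.sq_sqrt (mul_nonneg (exp_pos δ).le hc)]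
      exact hvar
    -- the variance of the increment: `Var(U - U') ≤ s²`
    have hVw : ∫ x, ((U x - U' x) - ∫ x', (U x' - U' x') ∂νt) ^ 2 ∂νt ≤ s ^ 2 / 1 := by
      have hvw := Literature.Probability.Moments.variance_le_sq_of_abs_le (μ := νt)
        (X := fun x => U x - U' x) (ae_of_all _ hs) hwm.aemeasurable
      rwa [variance_eq_integral hwm.aemeasurable, ← div_one (s ^ 2)] at hvw
    -- Cauchy–Schwarz
    exact (abs_integral_mul_sub_le_of_variance_le (ν := νt) one_pos (mul_nonneg hsc hL) hs0 hφm hφb hwm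
      ⟨s, hs⟩ hVφ hVw).trans (le_of_eq (div_one _))

/-- **Both directions at once** (the line a Dobrushin row sum consumes).  From the UNPERTURBED pair
`OneLinkPoincareSUN N R c`, `OneLinkVarianceBound N R v`: for `‖B‖_op, ‖B'‖_op ≤ R`, perturbations `U, U'` of oscillation
`≤ δ` with `|U − U'| ≤ s`, and bounded measurable `L`-Lipschitz `φ`,
`|∫ φ dν_{B,U} − ∫ φ dν_{B',U'}| ≤ e^δ √(c v) · L · ‖B − B'‖_F + √(e^δ c) · L · s`.
[cite: Follmer1988, Ch. I Theorem (2.13)] -/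
theorem abs_integral_pert_sub_pert_le_of_pair {R c v δ : ℝ} (hc : 0 ≤ c) (hv0 : 0 ≤ v) (hP : OneLinkPoincareSUN N R c)
    (hV : OneLinkVarianceBound N R v)
    {B B' : Matrix (Fin N) (Fin N) ℂ} (hB : matrixOpNorm B ≤ R) (hB' : matrixOpNorm B' ≤ R)
    {U U' : SUN N → ℝ} (hUm : Measurable U) (hUb : ∃ C, ∀ g, |U g| ≤ C)
    (hosc : ∀ g h, U g ≤ U h + δ) (hU'm : Measurable U') (hU'b : ∃ C, ∀ g, |U' g| ≤ C)
    (hosc' : ∀ g h, U' g ≤ U' h + δ) {s : ℝ} (hs : ∀ g, |U g - U' g| ≤ s)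
    (φ : SUN N → ℝ) (L : ℝ) (hφm : Measurable φ) (hφb : ∃ M, ∀ x, |φ x| ≤ M)
    (hL : 0 ≤ L) (hφL : ∀ a b, |φ a - φ b| ≤ L * suFrobDist a b) :
    |∫ x, φ x ∂((haarProbability (SUN N)).tilted fun g : SUN N => (N : ℝ) * ((g : Matrix (Fin N) (Fin N) ℂ) * B).trace.re + U g) -
        ∫ x, φ x ∂((haarProbability (SUN N)).tilted fun g : SUN N => (N : ℝ) * ((g : Matrix (Fin N) (Fin N) ℂ) * B').trace.re + U' g)| ≤
      exp δ * Real.sqrt (c * v) * L * frobNorm (B - B') + Real.sqrt (exp δ * c) * L * s := by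
  have h1 := abs_integral_pert_sub_le hc hv0 hP hV hUm hUb hosc hB hB' φ L hφm hφb hL hφL
  have h2 := abs_integral_pert_sub_pert_le hc hP hB' hUm hosc hU'm hU'b hosc' hs φ L hφm hφb hL hφL
  set I₁ : ℝ := ∫ x, φ x ∂((haarProbability (SUN N)).tilted fun g : SUN N => (N : ℝ) * ((g : Matrix (Fin N) (Fin N) ℂ) * B).trace.re + U g)
  set I₂ : ℝ := ∫ x, φ x ∂((haarProbability (SUN N)).tilted fun g : SUN N => (N : ℝ) * ((g : Matrix (Fin N) (Fin N) ℂ) * B').trace.re + U g)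
  set I₃ : ℝ := ∫ x, φ x ∂((haarProbability (SUN N)).tilted fun g : SUN N => (N : ℝ) * ((g : Matrix (Fin N) (Fin N) ℂ) * B').trace.re + U' g)
  calc |I₁ - I₃| = |(I₁ - I₂) + (I₂ - I₃)| := by ring_nf
    _ ≤ |I₁ - I₂| + |I₂ - I₃| := abs_add_le _ _
    _ ≤ _ := add_le_add h1 h2

/-! ## 3. Consistency: `U ≡ 0` is the Wilson law, and the modulus there is the tree's -/

/-- At `U ≡ 0` the perturbed law is the Wilson one-link law `ν_B`. [folklore] -/
theorem pert_zero (B : Matrix (Fin N) (Fin N) ℂ) :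
    ((haarProbability (SUN N)).tilted fun g : SUN N => (N : ℝ) * ((g : Matrix (Fin N) (Fin N) ℂ) * B).trace.re + (fun _ => (0 : ℝ)) g) =
      ((haarProbability (SUN N)).tilted fun g : SUN N => (N : ℝ) * ((g : Matrix (Fin N) (Fin N) ℂ) * B).trace.re) := by
  simp only [add_zero]

/-- **Consistency with the tree's Poincaré–variance modulus**: at `δ = 0`, `U ≡ 0` the tilt direction IS
`oneLinkKRModulus_of_poincare_of_varianceBound` — `OneLinkKRModulus N R √(c v)`. [cite: Follmer1988, Ch. I Theorem (2.13)] -/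
theorem oneLinkKRModulus_of_pert_zero {R c v : ℝ} (hc : 0 ≤ c) (hv0 : 0 ≤ v) (hP : OneLinkPoincareSUN N R c)
    (hV : OneLinkVarianceBound N R v) : OneLinkKRModulus N R (Real.sqrt (c * v)) := by
  intro B B' hB hB' φ L hφm hφb hL hφL
  have h := abs_integral_pert_sub_le (δ := 0) hc hv0 hP hV (U := fun _ => (0 : ℝ)) measurable_const
    ⟨0, fun _ => by simp⟩ (fun _ _ => by simp) hB hB' φ L hφm hφb hL hφL
  simpa only [pert_zero, exp_zero, one_mul] using h

end SUN

end Summit.Ventures.YMGap.OneLinkHolleyStroock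

end
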